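import Mathlib
import Summits.Ventures.HodgeRepro2.T5DyadicExamples
import Summits.Ventures.HodgeRepro2.T5CyclotomicDyadic

/-!
# T5CyclotomicUnramified — `p ∤ m` ⟹ `p` unramified in every subfield of `ℚ(ζ_m)`; the
conductor-31 cubic of N2.8.2(e)

Tier-5 support (seat p3) for sub-step N2 of `route/T5-N2-route-3.md`, §N2.8.2(b) («2 NEVER
RAMIFIES in F⁺ … so 2 is inert (g₂ = 1) … or splits completely (g₂ = 3)») and (e) («residual
shape: … F⁺ of conductor 31 is p3's example: 2 ≡ 4³ (mod 31) ⟹ 2 splits completely»).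

The record's (b) rests on Kronecker–Weber (`F⁺ ⊆ ℚ(ζ_f)`, `f` = the conductor, odd).  THIS file
is the kernel form of everything AFTER that embedding: for ANY `m` with `p ∤ m`, ANY field `E`
with `IsCyclotomicExtension {m} ℚ E` and ANY intermediate field `F` of `E/ℚ`,

* `F/ℚ` is Galois (`isGalois_intermediateField`: the Galois group of `ℚ(ζ_m)` is abelian —
  `IsCyclotomicExtension.autEquivPow` onto `(ZMod m)ˣ` — so every fixing subgroup is normal and
  `IsGalois.of_fixedField_normal_subgroup` applies);
* `p` is unramified in `F` (`ramificationIdx_eq_one`), its inertia degree divides both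
  `ord_m(p)` (`inertiaDeg_dvd_orderOf`) and `[F : ℚ]` (`inertiaDeg_dvd_finrank`), and
  `#{𝔭 | p}·f = [F : ℚ]` (`ncard_primesOver_mul_inertiaDeg`);
* hence `p` splits completely in `F` when `ord_m(p)` is coprime to `[F : ℚ]`
  (`ncard_primesOver_eq_finrank_of_coprime`), and for a CUBIC `F` the dichotomy of (b): `p` is
  inert (`f = 3`, one prime) or splits completely (`f = 1`, three primes)
  (`inert_or_splitsCompletely_of_finrank_three`, through `T5DyadicExamples.inert_or_split_of_unramified`).

§3 instantiates (e)'s «residual shape» field: in ANY `E` with `IsCyclotomicExtension {31} ℚ E`,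
`ord_31(2) = 5` (`orderOf_two_zmod_31`), so `2` splits completely in the cubic subfield (the
cyclic cubic of conductor 31: three primes above `2`, `ncard_primesOver_two_cubic_31`) and also in
the quadratic subfield (`ℚ(√−31)`, `−31 ≡ 1 (mod 8)`: two primes, `ncard_primesOver_two_quadratic_31`)
— so the sextic `ℚ(ζ₃₁) ⊇ F⁺K` with `K = ℚ(√−31)` is NOT of the residual shape («2 non-split in K»);
the residual shape pairs this `F⁺` with a quadratic `K` in which `2` does not split, as the record
says.

Honest scope — stays prose: Kronecker–Weber itself (the embedding `F⁺ ⊆ ℚ(ζ_f)`) and the conductor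
shape `3^a·∏ pᵢ` (hence `2 ∤ f`); completions.  Uses an L-value-free non-vanishing device: NO
(README §8(d)).
-/

namespace Summit.Ventures.HodgeRepro2.T5CyclotomicUnramified

open Ideal NumberField IntermediateField

/-! ## §1 Every intermediate field of a cyclotomic extension of `ℚ` is Galois over `ℚ` -/

section Galois

variable (E : Type*) [Field E] [NumberField E]

/-- The Galois group of `ℚ(ζ_m)/ℚ` is abelian (it embeds in `(ZMod m)ˣ` by
`IsCyclotomicExtension.autEquivPow`, `Φ_m` being irreducible over `ℚ`), so every subgroup is
normal. -/
theorem normal_subgroup_gal (m : ℕ) [NeZero m] [IsCyclotomicExtension {m} ℚ E]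
    (H : Subgroup (E ≃ₐ[ℚ] E)) : H.Normal := by
  let e := IsCyclotomicExtension.autEquivPow (n := m) E
    (Polynomial.cyclotomic.irreducible_rat (NeZero.pos m))
  exact ⟨fun n hn g => by
    have h : g * n * g⁻¹ = n := e.injective (by simp [map_mul, mul_assoc])
    rw [h]
    exact hn⟩

/-- Every intermediate field `F` of `ℚ(ζ_m)/ℚ` is Galois over `ℚ`: `F = fixedField (fixingSubgroup F)`
(`IsGalois.fixedField_fixingSubgroup`) and the fixing subgroup is normal (`normal_subgroup_gal`), so
`IsGalois.of_fixedField_normal_subgroup` applies. -/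
theorem isGalois_intermediateField (m : ℕ) [NeZero m] [IsCyclotomicExtension {m} ℚ E]
    (F : IntermediateField ℚ E) : IsGalois ℚ F := by
  haveI : IsGalois ℚ E := IsCyclotomicExtension.isGalois {m} ℚ E
  haveI : (fixingSubgroup F).Normal := normal_subgroup_gal E m _
  exact IsGalois.of_algEquiv (IntermediateField.equivOfEq (IsGalois.fixedField_fixingSubgroup F))

end Galois

/-! ## §2 `p ∤ m`: `p` is unramified in every subfield, `f ∣ ord_m(p)`, `f ∣ [F : ℚ]`, `r·f = [F : ℚ]` -/

section Unramified

variable {m : ℕ} [NeZero m] (p : ℕ) [Fact p.Prime] (E : Type*) [Field E] [NumberField E]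
  [IsCyclotomicExtension {m} ℚ E] (F : IntermediateField ℚ E)

/-- The ideal `(p)` of `ℤ` (maximal: `Int.ideal_span_isMaximal_of_prime`). -/
local notation3 "𝒑" => (span {(p : ℤ)} : Ideal ℤ)

/-- `p ∤ m` ⟹ `p` is unramified in every intermediate field `F` of `ℚ(ζ_m)`: it is unramified in
`E` (`IsCyclotomicExtension.Rat.ramificationIdx_eq_of_not_dvd`) and ramification indices multiply
in towers (`T5CyclotomicDyadic.ramificationIdx_eq_one_of_tower`). -/
theorem ramificationIdx_eq_one (hm : ¬ p ∣ m) (𝔭 : Ideal (𝓞 F)) [𝔭.IsPrime] [𝔭.LiesOver 𝒑] :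
    𝔭.ramificationIdx ℤ = 1 := by
  obtain ⟨⟨P, hP, hPF⟩⟩ := 𝔭.nonempty_primesOver (S := 𝓞 E)
  haveI : P.LiesOver 𝒑 := LiesOver.trans P 𝔭 𝒑
  exact (T5CyclotomicDyadic.ramificationIdx_eq_one_of_tower 𝔭 P
    (IsCyclotomicExtension.Rat.ramificationIdx_eq_of_not_dvd (m := m) p E P hm)).1

/-- `p ∤ m` ⟹ the inertia degree of a prime of `F` above `p` divides `ord_m(p)`, the inertia
degree of `p` in `E` (`IsCyclotomicExtension.Rat.inertiaDeg_eq_of_not_dvd`,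
`Ideal.inertiaDeg_below_dvd`). -/
theorem inertiaDeg_dvd_orderOf (hm : ¬ p ∣ m) (𝔭 : Ideal (𝓞 F)) [𝔭.IsPrime] [𝔭.LiesOver 𝒑] :
    𝔭.inertiaDeg ℤ ∣ orderOf (p : ZMod m) := by
  obtain ⟨⟨P, hP, hPF⟩⟩ := 𝔭.nonempty_primesOver (S := 𝓞 E)
  haveI : P.LiesOver 𝒑 := LiesOver.trans P 𝔭 𝒑
  rw [← IsCyclotomicExtension.Rat.inertiaDeg_eq_of_not_dvd (m := m) p E P hm]
  exact inertiaDeg_below_dvd (R := ℤ) 𝔭 P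

include m in
/-- The Galois fundamental identity for `F/ℚ` (Galois by `isGalois_intermediateField`), with the
invariants read off one prime `𝔭` above `p`: `#{𝔭 | p}·(e·f) = [F : ℚ]`. -/
theorem ncard_primesOver_mul (𝔭 : Ideal (𝓞 F)) [𝔭.IsPrime] [𝔭.LiesOver 𝒑] :
    (𝒑.primesOver (𝓞 F)).ncard * (𝔭.ramificationIdx ℤ * 𝔭.inertiaDeg ℤ) =
      Module.finrank ℚ F := by
  haveI : IsGalois ℚ F := isGalois_intermediateField E m F
  rw [← IsGaloisGroup.card_eq_finrank (F ≃ₐ[ℚ] F) ℚ F,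
    ← ncard_primesOver_mul_ramificationIdxIn_mul_inertiaDegIn 𝒑 (𝓞 F) (F ≃ₐ[ℚ] F),
    ramificationIdxIn_eq_ramificationIdx 𝒑 𝔭 (F ≃ₐ[ℚ] F),
    inertiaDegIn_eq_inertiaDeg 𝒑 𝔭 (F ≃ₐ[ℚ] F)]

/-- `p ∤ m` ⟹ `#{𝔭 | p}·f = [F : ℚ]` in every intermediate field `F` (`e = 1`). -/
theorem ncard_primesOver_mul_inertiaDeg (hm : ¬ p ∣ m) (𝔭 : Ideal (𝓞 F)) [𝔭.IsPrime]
    [𝔭.LiesOver 𝒑] : (𝒑.primesOver (𝓞 F)).ncard * 𝔭.inertiaDeg ℤ = Module.finrank ℚ F := by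
  have h := ncard_primesOver_mul (m := m) p E F 𝔭
  rwa [ramificationIdx_eq_one p E F hm 𝔭, one_mul] at h

/-- `p ∤ m` ⟹ the inertia degree of a prime of `F` above `p` divides `[F : ℚ]`. -/
theorem inertiaDeg_dvd_finrank (hm : ¬ p ∣ m) (𝔭 : Ideal (𝓞 F)) [𝔭.IsPrime] [𝔭.LiesOver 𝒑] :
    𝔭.inertiaDeg ℤ ∣ Module.finrank ℚ F :=
  Dvd.intro_left _ (ncard_primesOver_mul_inertiaDeg p E F hm 𝔭)

/-- `p ∤ m` and `ord_m(p)` coprime to `[F : ℚ]` ⟹ every prime of `F` above `p` has `f = 1`. -/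
theorem inertiaDeg_eq_one_of_coprime (hm : ¬ p ∣ m)
    (hc : Nat.Coprime (orderOf (p : ZMod m)) (Module.finrank ℚ F)) (𝔭 : Ideal (𝓞 F))
    [𝔭.IsPrime] [𝔭.LiesOver 𝒑] : 𝔭.inertiaDeg ℤ = 1 :=
  Nat.eq_one_of_dvd_coprimes hc (inertiaDeg_dvd_orderOf p E F hm 𝔭)
    (inertiaDeg_dvd_finrank p E F hm 𝔭)

/-- `p ∤ m` and `ord_m(p)` coprime to `[F : ℚ]` ⟹ `p` SPLITS COMPLETELY in `F`: `[F : ℚ]` primes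
above `p`. -/
theorem ncard_primesOver_eq_finrank_of_coprime (hm : ¬ p ∣ m)
    (hc : Nat.Coprime (orderOf (p : ZMod m)) (Module.finrank ℚ F)) :
    (𝒑.primesOver (𝓞 F)).ncard = Module.finrank ℚ F := by
  obtain ⟨⟨𝔭, h𝔭, h𝔭p⟩⟩ := 𝒑.nonempty_primesOver (S := 𝓞 F)
  have h := ncard_primesOver_mul_inertiaDeg p E F hm 𝔭
  rwa [inertiaDeg_eq_one_of_coprime p E F hm hc 𝔭, mul_one] at h

/-- N2.8.2(b)'s dichotomy for a CUBIC subfield `F` of `ℚ(ζ_m)` with `p ∤ m`: `p` is INERT in `F`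
(`f = 3`, exactly one prime above `p`) or SPLITS COMPLETELY (`f = 1`, three primes) — from
`#{𝔭 | p}·f = 3` through `T5DyadicExamples.inert_or_split_of_unramified`. -/
theorem inert_or_splitsCompletely_of_finrank_three (hm : ¬ p ∣ m) (hF : Module.finrank ℚ F = 3)
    (𝔭 : Ideal (𝓞 F)) [𝔭.IsPrime] [𝔭.LiesOver 𝒑] :
    (𝔭.inertiaDeg ℤ = 3 ∧ (𝒑.primesOver (𝓞 F)).ncard = 1) ∨
      (𝔭.inertiaDeg ℤ = 1 ∧ (𝒑.primesOver (𝓞 F)).ncard = 3) := by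
  have h := ncard_primesOver_mul (m := m) p E F 𝔭
  rw [hF] at h
  have h3 : 𝔭.ramificationIdx ℤ * 𝔭.inertiaDeg ℤ * (𝒑.primesOver (𝓞 F)).ncard = 3 := by
    rw [← h]; ring
  exact T5DyadicExamples.inert_or_split_of_unramified h3 (ramificationIdx_eq_one p E F hm 𝔭)

end Unramified

/-! ## §3 The conductor-31 cubic: `2 ≡ 4³ (mod 31)` ⟹ `2` splits completely in `F⁺` -/

section ThirtyOne

/-- The ideal `(2)` of `ℤ`. -/
local notation3 "𝒑₂" => (span {((2 : ℕ) : ℤ)} : Ideal ℤ)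

/-- `ord_31(2) = 5` (`2⁵ = 32 ≡ 1 (mod 31)`, no smaller positive power). -/
theorem orderOf_two_zmod_31 : orderOf (2 : ZMod 31) = 5 := by
  rw [orderOf_eq_iff (by norm_num)]
  refine ⟨by decide, fun k hk hk0 => ?_⟩
  interval_cases k <;> decide

variable (E : Type*) [Field E] [NumberField E] [IsCyclotomicExtension {31} ℚ E]
  (F : IntermediateField ℚ E)

/-- In the cubic subfield of `ℚ(ζ₃₁)` (the cyclic cubic field of conductor 31), `2` SPLITS
COMPLETELY: three primes above `2` — N2.8.2(e)'s «2 ≡ 4³ (mod 31) ⟹ 2 splits completely»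
(`ord_31(2) = 5` is coprime to `3`). -/
theorem ncard_primesOver_two_cubic_31 (hF : Module.finrank ℚ F = 3) :
    (𝒑₂.primesOver (𝓞 F)).ncard = 3 := by
  rw [← hF]
  refine ncard_primesOver_eq_finrank_of_coprime (m := 31) 2 E F (by decide) ?_
  rw [hF]
  have h5 : orderOf ((2 : ℕ) : ZMod 31) = 5 := by exact_mod_cast orderOf_two_zmod_31
  rw [h5]
  decide

/-- In the cubic subfield of `ℚ(ζ₃₁)`, every prime above `2` has `f = 1` and `e = 1`. -/
theorem inertiaDeg_two_cubic_31 (hF : Module.finrank ℚ F = 3) (𝔭 : Ideal (𝓞 F)) [𝔭.IsPrime]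
    [𝔭.LiesOver 𝒑₂] : 𝔭.inertiaDeg ℤ = 1 ∧ 𝔭.ramificationIdx ℤ = 1 := by
  refine ⟨?_, ramificationIdx_eq_one (m := 31) 2 E F (by decide) 𝔭⟩
  refine inertiaDeg_eq_one_of_coprime (m := 31) 2 E F (by decide) ?_ 𝔭
  rw [hF]
  have h5 : orderOf ((2 : ℕ) : ZMod 31) = 5 := by exact_mod_cast orderOf_two_zmod_31
  rw [h5]
  decide

/-- In the quadratic subfield of `ℚ(ζ₃₁)` (`ℚ(√−31)`, `−31 ≡ 1 (mod 8)`), `2` SPLITS: two primes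
above `2` (`ord_31(2) = 5` is coprime to `2`) — so `ℚ(ζ₃₁)`'s own sextic subfield is NOT the
«residual shape» of N2.8.2(e), which needs `2` non-split in `K`. -/
theorem ncard_primesOver_two_quadratic_31 (K : IntermediateField ℚ E)
    (hK : Module.finrank ℚ K = 2) : (𝒑₂.primesOver (𝓞 K)).ncard = 2 := by
  refine (ncard_primesOver_eq_finrank_of_coprime (m := 31) 2 E K (by decide) ?_).trans hK
  rw [hK]
  have h5 : orderOf ((2 : ℕ) : ZMod 31) = 5 := by exact_mod_cast orderOf_two_zmod_31
  rw [h5]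
  decide

end ThirtyOne

end Summit.Ventures.HodgeRepro2.T5CyclotomicUnramified
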